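import Summits.MatrixMultiplication.OmegaCensus.STPPVosperTilingLawW
import Summits.MatrixMultiplication.OmegaCensus.STPP222SqSymmetry
import Summits.MatrixMultiplication.OmegaCensus.STPPVosperClash61Tools

/-!
# ω-census (abelian STPP census): an UNCONDITIONAL kill at `ℤ₆₁` by the Vosper tiling law with words — `{(1,1,2),(3,5,2),(3,5,2)}` (kernel)

HONEST FRAMING (pub-omega census; verbatim): lottery ticket; floor = certified bounds/negative ranges.
Census STRUCTURE (seat pub-omega-stpp-1 gen 32, 2026-08-28), family (b2).  First application of `no_isSTPP_of_tight_tiling_prime_words`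
(`STPPVosperTilingLawW.lean`): the pattern `K5 = {(1,1,2),(3,5,2),(3,5,2)}` is a leaf of the `ℤ₆₁` residual front of record that every window-table law
leaves open (HOME `pub-omega-stpp-1-g31/scan/KERNEL-HR-KILLS-Z61.json`, `still_kernel_open`).  In the reading `(a,c,b)` — the STPP family `(A, C, B)`,
sizes `(1,2,1), (3,2,5), (3,2,5)` — block `1` is tight: `(z, b, vol, a, L) = (16, 2, 30, 3, 12)`, `16 + 2 + 30 + 3 + 12 = 63 = 61 + 2`; the window table
`(n, m, r) = (44, 14, 2)` has survivors `j ∈ {0, 1, 3, 30, 31, 58, 60}`; `0, ±1, ±2⁻¹ = 30, 31` are word ratios (`a = 3`, `b = 2`); for `j ∈ {3, 58}` the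
other blocks `(1,2,1)` and `(3,2,5)` DO admit exact covers of the progressions `Y°` (12 terms, step `j`) and `Z°` (16 terms, step `1`) — the plain cover stage
of gen 30 is inconclusive here (HOME `pub-omega-stpp-1-g30/TILING-PILOT.md`) — but NONE survives the Def-5.1 words among those two blocks:
`existsCoverW … = false`, two kernel computations of about half a minute (candidate lists `12 × 1032`).  UNCONDITIONAL (Vosper only; no Hamidoune–Rødseth).
Nothing here is progress on `ω`.  Python mirrors (code-disjoint): HOME `pub-omega-stpp-1-g32/code/coverw_mirror.py` (exact semantics of `existsCoverW`),
`pub-omega-stpp-2-g25/code/pilot/cover3.py` + `k5check.py` (two-stage search; all 60 ratios dead).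

References: A. G. Vosper, J. London Math. Soc. 31 (1956); M. B. Nathanson, GTM 165, Thm 2.7; H. Cohn, R. Kleinberg, B. Szegedy, C. Umans, FOCS 2005
(arXiv:math/0511460), Def. 5.1.
-/

open Finset
open scoped Pointwise

namespace Summit.MatrixMultiplication.OmegaCensus.CubeNB

open Literature.Computability.AlgebraicComplexity
open Literature.Combinatorics.Additive
open Summit.MatrixMultiplication.OmegaCensus.STPPKneser

/-! ## Table, covers and split -/

section Tables

/-- Tight-type table `(n, m, r) = (44, 14, 2)` at `61` with the survivor target `{0, 1, 60, 30, 31, 3, 58}`. [folklore] -/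
theorem table61_44_14_2_surv : ∀ j < 61, ∀ t < 61, (∀ i < 14, (t + j * i) % 61 < 44) →
    (∀ k < 14, 2 ∣ (t + j * k) % 61 - #((range 14).filter fun i => (t + j * i) % 61 < (t + j * k) % 61)) →
    j ∈ ({0, 1, 60, 30, 31, 3, 58} : Finset ℕ) := by
  decide +kernel

/-- The exact-cover search WITH WORDS for the ratio `j = 3` (other blocks `(1,2,1)`, `(3,2,5)`; `L = 12`, `z = 16`) FAILS. [folklore] -/
theorem coverW61_121_325_fail_3 :
    existsCoverW 61 ((List.range 12).map fun t => (3 * t) % 61) (List.range 16)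
      ([((1 : ℕ), (2 : ℕ), (1 : ℕ)), (3, 2, 5)].map fun s => blockDiffsW 61 ((List.range 12).map fun t => (3 * t) % 61) (List.range 16) s.1 s.2.1 s.2.2)
      [] [] [] = false := by
  decide +kernel

/-- The exact-cover search WITH WORDS for the ratio `j = 58` FAILS. [folklore] -/
theorem coverW61_121_325_fail_58 :
    existsCoverW 61 ((List.range 12).map fun t => (58 * t) % 61) (List.range 16)
      ([((1 : ℕ), (2 : ℕ), (1 : ℕ)), (3, 2, 5)].map fun s => blockDiffsW 61 ((List.range 12).map fun t => (58 * t) % 61) (List.range 16) s.1 s.2.1 s.2.2)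
      [] [] [] = false := by
  decide +kernel

/-- The split of the survivor target: word ratios (`0`, `±1`, `±2⁻¹` for `a = 3`, `b = 2`) or a failed exact-cover search with words. [folklore] -/
theorem split61_121_325_325 : ∀ jv ∈ ({0, 1, 60, 30, 31, 3, 58} : Finset ℕ),
    (jv = 0 ∨ (∃ k ∈ range 2, 1 ≤ k ∧ (jv = k ∨ jv + k = 61)) ∨ (∃ k ∈ range 3, 1 ≤ k ∧ (jv * k % 61 = 1 ∨ jv * k % 61 = 61 - 1))) ∨
      existsCoverW 61 ((List.range 12).map fun t => (jv * t) % 61) (List.range 16)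
        ([((1 : ℕ), (2 : ℕ), (1 : ℕ)), (3, 2, 5)].map fun s =>
          blockDiffsW 61 ((List.range 12).map fun t => (jv * t) % 61) (List.range 16) s.1 s.2.1 s.2.2) [] [] [] = false := by
  intro jv hjv
  have hcases : jv ∈ ({0, 1, 60, 30, 31} : Finset ℕ) ∨ jv = 3 ∨ jv = 58 := by
    revert hjv; revert jv; decide
  rcases hcases with h | rfl | rfl
  · left; revert h; revert jv; decide
  · right; exact coverW61_121_325_fail_3
  · right; exact coverW61_121_325_fail_58

end Tables

/-! ## The kill -/

section Kills

/-- **`{(1,1,2),(3,5,2),(3,5,2)}` has no STPP family in `ℤ/61ℤ`** — UNCONDITIONAL (Vosper tiling law with words in the reading `(a,c,b)`, i.e. for the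
STPP family `(A, C, B)`, tight block `1` of sizes `(3,2,5)`: `(z, b, vol, a, L) = (16, 2, 30, 3, 12)`, table `(44,14,2)`, word ratios `±1, ±2⁻¹`, and for
`j ∈ {3, 58}` no exact cover of `Y°`, `Z°` by the blocks `(1,2,1)`, `(3,2,5)` survives the Def-5.1 words among them).
[cite: CohnKleinbergSzegedyUmans2005, Def. 5.1] [cite: Vosper1956, main theorem; Nathanson1996, Thm 2.7] -/
theorem no_isSTPP_zmod61_112_352_352 (A B C : Fin 3 → Finset (ZMod 61)) (hS : IsSTPP A B C)
    (hA : ∀ i, #(A i) = ![1, 3, 3] i) (hB : ∀ i, #(B i) = ![1, 5, 5] i) (hC : ∀ i, #(C i) = ![2, 2, 2] i) : False := by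
  haveI : Fact (Nat.Prime 61) := ⟨prime_61⟩
  have hS' : IsSTPP A C B := STPP222SqNeg.isSTPP_swapBC hS
  have hAne : ∀ i, (A i).Nonempty := fun i => card_pos.1 (by rw [hA]; fin_cases i <;> simp)
  have hBne : ∀ i, (B i).Nonempty := fun i => card_pos.1 (by rw [hB]; fin_cases i <;> simp)
  have hCne : ∀ i, (C i).Nonempty := fun i => card_pos.1 (by rw [hC]; fin_cases i <;> simp)
  have e1 : (univ : Finset (Fin 3)).erase 1 = {0, 2} := by decide
  have hz : ∑ k ∈ (univ : Finset (Fin 3)).erase 1, #(A k) * #(B k) = 16 := by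
    rw [e1, Finset.sum_pair (by decide)]; simp [hA, hB]
  have hL : ∑ k ∈ (univ : Finset (Fin 3)).erase 1, #(C k) * #(B k) = 12 := by
    rw [e1, Finset.sum_pair (by decide)]; simp [hB, hC]
  have ha : #(A 1) = 3 := by rw [hA]; simp
  have hb : #(C 1) = 2 := by rw [hC]; simp
  have hvol : #(A 1) * #(C 1) * #(B 1) = 30 := by rw [hA, hB, hC]; simp
  refine no_isSTPP_of_tight_tiling_prime_words A C B hS' hAne hCne hBne 1 ⟨0, by decide⟩ ha hb hvol hz hL (by norm_num) (by norm_num)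
    (by norm_num) (by norm_num) (by norm_num) (m := 14) (n := 44) rfl rfl [0, 2] (by decide) (fun k => by fin_cases k <;> decide)
    table61_44_14_2_surv (fun jv hjv => ?_)
  have hsz : ([0, 2] : List (Fin 3)).map (fun k => blockDiffsW 61 ((List.range 12).map fun t => (jv * t) % 61) (List.range 16) #(A k) #(C k) #(B k)) =
      [((1 : ℕ), (2 : ℕ), (1 : ℕ)), (3, 2, 5)].map fun s =>
        blockDiffsW 61 ((List.range 12).map fun t => (jv * t) % 61) (List.range 16) s.1 s.2.1 s.2.2 := by
    simp [hA, hB, hC]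
  rw [hsz]
  exact split61_121_325_325 jv hjv

end Kills

end Summit.MatrixMultiplication.OmegaCensus.CubeNB
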